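import Summits.Ventures.PackingBounds.Configurations.ListConfigKeys
import Summits.Ventures.PackingBounds.Configurations.SectionTransfer
import Mathlib.NumberTheory.Zsqrtd.ToReal

/-!
# `A(11, arccos 1/3) ≥ 156`: the sum-zero slice of the hexad code, plus the `24` centred axes

Framing: lottery ticket; floor = certified bounds/negative ranges. Venture `PackingBounds` (cell `pub-packcert`, seat
`pub-packcert-sdp`, B2c ATTAINED side, cell `(11, 1/3)`; previous kernel value `136` = Construction A on a maximal packing
of triples, `CodesThirdConsASteiner`; certified upper value `182`). Kind (b): an explicit object written down here; no
optimality claim; UNCOUNTED.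

The `132` hexads of the Steiner system `S(5, 6, 12)` (generated below as the `PSL(2, 11)`-orbit of `{0, 1, 3, 4, 5, 9}` on
`P¹(𝔽₁₁)`, `∞ ↦ 11`) give sign vectors `h ∈ {±1}¹²` (`+1` on the hexad) with `Σ hᵢ = 0`; two hexads meet in `0, 2, 3` or
`4` points, so `h·h' ∈ {−12, −4, 0, 4}` (cosines `−1, −1/3, 0, 1/3`; `CodeThird12Hexads` uses the same words inside `ℝ¹²`).
All of them lie in the hyperplane `𝟙^⊥ ≅ ℝ¹¹`, and so do the `24` vectors `±(12 e_i − 𝟙)` (squared length `132`, mutual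
products `∓12`, products `±12 hᵢ` with the hexad vectors).  Scaling the hexad vectors by `√11` puts all `156` vectors on the
sphere of squared radius `132` in `ℤ[√11]¹²` with pairwise products in
`{44, 0, −44, −132, ±12√11, ±12}` — all `≤ 132/3 = 44` since `12√11 < 44` — hence cosines `≤ 1/3`.
Kernel content: `ListConfigKeys` over `ℤ[√11]` (`Zsqrtd 11`, embedding `Zsqrtd.toReal`): `shapeOK`, `keysRowsOK` (three
chunks), `normalsOK`/`orthOK` for the normal `𝟙` by `decide`; the codimension-one transfer to `ℝ¹¹` is
`Config.exists_transfer_orthogonal` (`SubspaceTransfer`) with `Config.linearIndependent_normals` /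
`Config.inner_normals_eq_zero` (`SectionTransfer`), inlined here.  Result:
**`exists_code_dim11_third_156 : A(11, arccos 1/3) ≥ 156`**.
-/

namespace Summit.Ventures.PackingBounds.Config.CodeThird11Hexads

open Finset Summit.Ventures.PackingBounds.Config

/-- `0 ≤ 11`. -/
private theorem hD : (0 : ℤ) ≤ 11 := by norm_num

/-- `11` is not a square. -/
private theorem d_not_square : ∀ k : ℤ, (11 : ℤ) ≠ k * k := by
  intro k h
  have h1 : k.natAbs * k.natAbs = 11 := by
    have := Int.natAbs_mul_self' k; omega
  have h2 : k.natAbs ≤ 3 := by nlinarith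
  interval_cases h : k.natAbs <;> omega

/-- `√11`. -/
def r : Zsqrtd 11 := ⟨0, 1⟩
/-- `−√11`. -/
def s : Zsqrtd 11 := ⟨0, -1⟩
/-- `11`. -/
def e : Zsqrtd 11 := ⟨11, 0⟩
/-- `−11`. -/
def f : Zsqrtd 11 := ⟨-11, 0⟩
/-- `1`. -/
def p : Zsqrtd 11 := ⟨1, 0⟩
/-- `−1`. -/
def m : Zsqrtd 11 := ⟨-1, 0⟩

set_option maxHeartbeats 4000000 in
/-- Hexad sign vectors `1 … 66` (scaled by `√11`: entries `r = √11` on the hexad, `s = −√11` off it). -/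
def rowsA : List (List (Zsqrtd 11)) := [
  [r, r, r, r, r, s, r, s, s, s, s, s],
  [r, r, r, r, s, r, s, s, s, s, r, s],
  [r, r, r, r, s, s, s, r, r, s, s, s],
  [r, r, r, r, s, s, s, s, s, r, s, r],
  [r, r, r, s, r, r, s, s, r, s, s, s],
  [r, r, r, s, r, s, s, r, s, s, s, r],
  [r, r, r, s, r, s, s, s, s, r, r, s],
  [r, r, r, s, s, r, r, s, s, s, s, r],
  [r, r, r, s, s, r, s, r, s, r, s, s],
  [r, r, r, s, s, s, r, r, s, s, r, s],
  [r, r, r, s, s, s, r, s, r, r, s, s],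
  [r, r, r, s, s, s, s, s, r, s, r, r],
  [r, r, s, r, r, r, s, s, s, r, s, s],
  [r, r, s, r, r, s, s, r, s, s, r, s],
  [r, r, s, r, r, s, s, s, r, s, s, r],
  [r, r, s, r, s, r, r, s, r, s, s, s],
  [r, r, s, r, s, r, s, r, s, s, s, r],
  [r, r, s, r, s, s, r, r, s, r, s, s],
  [r, r, s, r, s, s, r, s, s, s, r, r],
  [r, r, s, r, s, s, s, s, r, r, r, s],
  [r, r, s, s, r, r, r, r, s, s, s, s],
  [r, r, s, s, r, r, s, s, s, s, r, r],
  [r, r, s, s, r, s, r, s, r, s, r, s],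
  [r, r, s, s, r, s, r, s, s, r, s, r],
  [r, r, s, s, r, s, s, r, r, r, s, s],
  [r, r, s, s, s, r, r, s, s, r, r, s],
  [r, r, s, s, s, r, s, r, r, s, r, s],
  [r, r, s, s, s, r, s, s, r, r, s, r],
  [r, r, s, s, s, s, r, r, r, s, s, r],
  [r, r, s, s, s, s, s, r, s, r, r, r],
  [r, s, r, r, r, r, s, s, s, s, s, r],
  [r, s, r, r, r, s, s, r, s, r, s, s],
  [r, s, r, r, r, s, s, s, r, s, r, s],
  [r, s, r, r, s, r, r, r, s, s, s, s],
  [r, s, r, r, s, r, s, s, r, r, s, s],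
  [r, s, r, r, s, s, r, s, r, s, s, r],
  [r, s, r, r, s, s, r, s, s, r, r, s],
  [r, s, r, r, s, s, s, r, s, s, r, r],
  [r, s, r, s, r, r, r, s, s, r, s, s],
  [r, s, r, s, r, r, s, r, s, s, r, s],
  [r, s, r, s, r, s, r, r, r, s, s, s],
  [r, s, r, s, r, s, r, s, s, s, r, r],
  [r, s, r, s, r, s, s, s, r, r, s, r],
  [r, s, r, s, s, r, r, s, r, s, r, s],
  [r, s, r, s, s, r, s, r, r, s, s, r],
  [r, s, r, s, s, r, s, s, s, r, r, r],
  [r, s, r, s, s, s, r, r, s, r, s, r],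
  [r, s, r, s, s, s, s, r, r, r, r, s],
  [r, s, s, r, r, r, r, s, s, s, r, s],
  [r, s, s, r, r, r, s, r, r, s, s, s],
  [r, s, s, r, r, s, r, r, s, s, s, r],
  [r, s, s, r, r, s, r, s, r, r, s, s],
  [r, s, s, r, r, s, s, s, s, r, r, r],
  [r, s, s, r, s, r, r, s, s, r, s, r],
  [r, s, s, r, s, r, s, r, s, r, r, s],
  [r, s, s, r, s, r, s, s, r, s, r, r],
  [r, s, s, r, s, s, r, r, r, s, r, s],
  [r, s, s, r, s, s, s, r, r, r, s, r],
  [r, s, s, s, r, r, r, s, r, s, s, r],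
  [r, s, s, s, r, r, s, r, s, r, s, r],
  [r, s, s, s, r, r, s, s, r, r, r, s],
  [r, s, s, s, r, s, r, r, s, r, r, s],
  [r, s, s, s, r, s, s, r, r, s, r, r],
  [r, s, s, s, s, r, r, r, r, r, s, s],
  [r, s, s, s, s, r, r, r, s, s, r, r],
  [r, s, s, s, s, s, r, s, r, r, r, r]]

set_option maxHeartbeats 4000000 in
/-- Hexad sign vectors `67 … 132`. -/
def rowsB : List (List (Zsqrtd 11)) := [
  [s, r, r, r, r, r, s, r, s, s, s, s],
  [s, r, r, r, r, s, s, s, r, r, s, s],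
  [s, r, r, r, r, s, s, s, s, s, r, r],
  [s, r, r, r, s, r, r, s, s, r, s, s],
  [s, r, r, r, s, r, s, s, r, s, s, r],
  [s, r, r, r, s, s, r, r, s, s, s, r],
  [s, r, r, r, s, s, r, s, r, s, r, s],
  [s, r, r, r, s, s, s, r, s, r, r, s],
  [s, r, r, s, r, r, r, s, s, s, r, s],
  [s, r, r, s, r, r, s, s, s, r, s, r],
  [s, r, r, s, r, s, r, r, s, r, s, s],
  [s, r, r, s, r, s, r, s, r, s, s, r],
  [s, r, r, s, r, s, s, r, r, s, r, s],
  [s, r, r, s, s, r, r, r, r, s, s, s],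
  [s, r, r, s, s, r, s, r, s, s, r, r],
  [s, r, r, s, s, r, s, s, r, r, r, s],
  [s, r, r, s, s, s, r, s, s, r, r, r],
  [s, r, r, s, s, s, s, r, r, r, s, r],
  [s, r, s, r, r, r, r, s, s, s, s, r],
  [s, r, s, r, r, r, s, s, r, s, r, s],
  [s, r, s, r, r, s, r, r, r, s, s, s],
  [s, r, s, r, r, s, r, s, s, r, r, s],
  [s, r, s, r, r, s, s, r, s, r, s, r],
  [s, r, s, r, s, r, r, r, s, s, r, s],
  [s, r, s, r, s, r, s, r, r, r, s, s],
  [s, r, s, r, s, r, s, s, s, r, r, r],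
  [s, r, s, r, s, s, r, s, r, r, s, r],
  [s, r, s, r, s, s, s, r, r, s, r, r],
  [s, r, s, s, r, r, r, s, r, r, s, s],
  [s, r, s, s, r, r, s, r, r, s, s, r],
  [s, r, s, s, r, r, s, r, s, r, r, s],
  [s, r, s, s, r, s, r, r, s, s, r, r],
  [s, r, s, s, r, s, s, s, r, r, r, r],
  [s, r, s, s, s, r, r, r, s, r, s, r],
  [s, r, s, s, s, r, r, s, r, s, r, r],
  [s, r, s, s, s, s, r, r, r, r, r, s],
  [s, s, r, r, r, r, r, s, r, s, s, s],
  [s, s, r, r, r, r, s, s, s, r, r, s],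
  [s, s, r, r, r, s, r, r, s, s, r, s],
  [s, s, r, r, r, s, r, s, s, r, s, r],
  [s, s, r, r, r, s, s, r, r, s, s, r],
  [s, s, r, r, s, r, r, s, s, s, r, r],
  [s, s, r, r, s, r, s, r, r, s, r, s],
  [s, s, r, r, s, r, s, r, s, r, s, r],
  [s, s, r, r, s, s, r, r, r, r, s, s],
  [s, s, r, r, s, s, s, s, r, r, r, r],
  [s, s, r, s, r, r, r, r, s, s, s, r],
  [s, s, r, s, r, r, s, r, r, r, s, s],
  [s, s, r, s, r, r, s, s, r, s, r, r],
  [s, s, r, s, r, s, r, s, r, r, r, s],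
  [s, s, r, s, r, s, s, r, s, r, r, r],
  [s, s, r, s, s, r, r, r, s, r, r, s],
  [s, s, r, s, s, r, r, s, r, r, s, r],
  [s, s, r, s, s, s, r, r, r, s, r, r],
  [s, s, s, r, r, r, r, r, s, r, s, s],
  [s, s, s, r, r, r, s, r, s, s, r, r],
  [s, s, s, r, r, r, s, s, r, r, s, r],
  [s, s, s, r, r, s, r, s, r, s, r, r],
  [s, s, s, r, r, s, s, r, r, r, r, s],
  [s, s, s, r, s, r, r, r, r, s, s, r],
  [s, s, s, r, s, r, r, s, r, r, r, s],
  [s, s, s, r, s, s, r, r, s, r, r, r],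
  [s, s, s, s, r, r, r, r, r, s, r, s],
  [s, s, s, s, r, r, r, s, s, r, r, r],
  [s, s, s, s, r, s, r, r, r, r, s, r],
  [s, s, s, s, s, r, s, r, r, r, r, r]]

set_option maxHeartbeats 4000000 in
/-- The `24` centred axes `±(12 e_i − 𝟙)` (entries `e = 11`, `m = −1`, resp. `f = −11`, `p = 1`). -/
def rowsC : List (List (Zsqrtd 11)) := [
  [e, m, m, m, m, m, m, m, m, m, m, m],
  [f, p, p, p, p, p, p, p, p, p, p, p],
  [m, e, m, m, m, m, m, m, m, m, m, m],
  [p, f, p, p, p, p, p, p, p, p, p, p],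
  [m, m, e, m, m, m, m, m, m, m, m, m],
  [p, p, f, p, p, p, p, p, p, p, p, p],
  [m, m, m, e, m, m, m, m, m, m, m, m],
  [p, p, p, f, p, p, p, p, p, p, p, p],
  [m, m, m, m, e, m, m, m, m, m, m, m],
  [p, p, p, p, f, p, p, p, p, p, p, p],
  [m, m, m, m, m, e, m, m, m, m, m, m],
  [p, p, p, p, p, f, p, p, p, p, p, p],
  [m, m, m, m, m, m, e, m, m, m, m, m],
  [p, p, p, p, p, p, f, p, p, p, p, p],
  [m, m, m, m, m, m, m, e, m, m, m, m],
  [p, p, p, p, p, p, p, f, p, p, p, p],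
  [m, m, m, m, m, m, m, m, e, m, m, m],
  [p, p, p, p, p, p, p, p, f, p, p, p],
  [m, m, m, m, m, m, m, m, m, e, m, m],
  [p, p, p, p, p, p, p, p, p, f, p, p],
  [m, m, m, m, m, m, m, m, m, m, e, m],
  [p, p, p, p, p, p, p, p, p, p, f, p],
  [m, m, m, m, m, m, m, m, m, m, m, e],
  [p, p, p, p, p, p, p, p, p, p, p, f]]

/-- All `156` rows. -/
def rows : List (List (Zsqrtd 11)) := rowsA ++ rowsB ++ rowsC

/-- Admissible products of two distinct rows (squared length `132`): `44, 0, −44, −132` (hexad–hexad), `±12√11`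
(hexad–axis), `12, −12` (axis–axis); `−132` also for antipodal pairs. -/
def keys : List (Zsqrtd 11) := [⟨44, 0⟩, ⟨0, 0⟩, ⟨-44, 0⟩, ⟨-132, 0⟩, ⟨0, 12⟩, ⟨0, -12⟩, ⟨12, 0⟩, ⟨-12, 0⟩]

/-- The normal: `𝟙 ∈ ℤ[√11]¹²`. -/
def ones : List (List (Zsqrtd 11)) := [[p, p, p, p, p, p, p, p, p, p, p, p]]

/-- Kernel check: `156` rows. -/
theorem length_rows : rows.length = 156 := by decide +kernel

set_option maxRecDepth 100000 in
/-- Kernel check: every row has length `12` and squared length `132`. -/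
theorem shape_rows : shapeOK rows 12 (⟨132, 0⟩ : Zsqrtd 11) = true := by decide +kernel

set_option maxRecDepth 100000 in
set_option maxHeartbeats 4000000 in
/-- Kernel check (chunk A): products of the rows of `rowsA` with the other rows are keys. -/
theorem keys_rowsA : keysRowsOK rows keys rowsA = true := by decide +kernel

set_option maxRecDepth 100000 in
set_option maxHeartbeats 4000000 in
/-- Kernel check (chunk B). -/
theorem keys_rowsB : keysRowsOK rows keys rowsB = true := by decide +kernel

set_option maxRecDepth 100000 in
set_option maxHeartbeats 4000000 in
/-- Kernel check (chunk C). -/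
theorem keys_rowsC : keysRowsOK rows keys rowsC = true := by decide +kernel

/-- Kernel check: every product of two distinct rows is one of the `keys`. -/
theorem keys_rows : keysRowsOK rows keys rows = true := by
  show keysRowsOK rows keys (rowsA ++ rowsB ++ rowsC) = true
  simp only [keysRowsOK_append, keys_rowsA, keys_rowsB, keys_rowsC, Bool.and_self]

set_option maxRecDepth 100000 in
/-- Kernel check: `𝟙` is a nonzero normal (frame of size one). -/
theorem normals_ones : normalsOK ones 12 = true := by decide +kernel

set_option maxRecDepth 100000 in
/-- Kernel check: every row is orthogonal to `𝟙` (the code lies in the hyperplane `𝟙^⊥`). -/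
theorem orth_ones : orthOK ones rows = true := by decide +kernel

/-- `132` is not a key. -/
private theorem q_not_key : (⟨132, 0⟩ : Zsqrtd 11) ∉ keys := by decide

/-- `ι 132 > 0`. -/
private theorem hq : 0 < (Zsqrtd.toReal hD) (⟨132, 0⟩ : Zsqrtd 11) := by
  rw [Zsqrtd.toReal_apply]; push_cast; norm_num

/-- Every key, normalised by `132`, is `≤ 1/3` (for `12√11` this is `3√11 ≤ 11`, i.e. `99 ≤ 121`). -/
private theorem keys_le : ∀ k ∈ keys,
    (Zsqrtd.toReal hD) k / (Zsqrtd.toReal hD) (⟨132, 0⟩ : Zsqrtd 11) ≤ 1 / 3 := by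
  have hs : Real.sqrt 11 * Real.sqrt 11 = 11 := Real.mul_self_sqrt (by norm_num)
  have hs0 : 0 ≤ Real.sqrt 11 := Real.sqrt_nonneg 11
  intro k hk
  simp only [keys, List.mem_cons, List.not_mem_nil, or_false] at hk
  rw [div_le_div_iff₀ hq (by norm_num)]
  rcases hk with rfl | rfl | rfl | rfl | rfl | rfl | rfl | rfl <;>
    (rw [Zsqrtd.toReal_apply, Zsqrtd.toReal_apply]; push_cast; nlinarith)

/-- **`A(11, arccos 1/3) ≥ 156`**: `156` unit vectors of `ℝ¹¹` with pairwise inner products `≤ 1/3` — the `132` hexad sign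
vectors of `S(5,6,12)` and the `24` centred axes `±(12e_i − 𝟙)/√132`, all inside the hyperplane `𝟙^⊥` of `ℝ¹²`, moved to
`ℝ¹¹` by an inner-product-preserving map. -/
theorem exists_code_dim11_third_156 : ∃ C : Finset (EuclideanSpace ℝ (Fin 11)), C.card = 156 ∧
    (∀ x ∈ C, ‖x‖ = 1) ∧ ∀ x ∈ C, ∀ y ∈ C, x ≠ y → inner ℝ x y ≤ 1 / 3 := by
  have hι := Zsqrtd.toReal_injective hD d_not_square
  obtain ⟨C', hcard, hnorm, hinner, -⟩ := exists_transfer_orthogonal (m := 12) (n := 11) (k := ones.length) rfl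
    (fun i : Fin ones.length => vec (Zsqrtd.toReal hD) 12 (⟨132, 0⟩ : Zsqrtd 11) ones[(i : ℕ)])
    (linearIndependent_normals hι hq ones normals_ones)
    (config (Zsqrtd.toReal hD) 12 (⟨132, 0⟩ : Zsqrtd 11) rows) (inner_normals_eq_zero hq shape_rows ones normals_ones orth_ones)
  refine ⟨C', ?_, ?_, ?_⟩
  · rw [hcard, card_eq_keys hι hq shape_rows keys_rows q_not_key, length_rows]
  · intro x' hx'
    obtain ⟨x, hx, he⟩ := hnorm x' hx'
    rw [he]
    exact norm_eq_one hq shape_rows x hx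
  · intro x' hx' y' hy' hne
    obtain ⟨x, hx, y, hy, hxy, he⟩ := hinner x' hx' y' hy' hne
    rw [he]
    exact inner_le_keys hq shape_rows keys_rows (1 / 3) keys_le x hx y hy hxy

end Summit.Ventures.PackingBounds.Config.CodeThird11Hexads
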